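import Literature.AnabelianGeometry.EtaleTheta.Discharge.Sec2Cor29ModelKrull
import Literature.AnabelianGeometry.EtaleTheta.Discharge.Sec2CoverModelOfCuspLaws
import Literature.AnabelianGeometry.EtaleTheta.SettingModelKrullCuspCommTerminalC
import Literature.AnabelianGeometry.EtaleTheta.SettingModelKrullCuspNotIsoPreservesCuspidal
import Literature.AnabelianGeometry.EtaleTheta.SettingModelKrullKummerDataEmpty
import Literature.AnabelianGeometry.EtaleTheta.Discharge.Sec2HasMuLOfSetting
import HarnessLib

/-!
# [EtTh] Cor. 2.9 at the cusped untwisted Krull model `κ′`, REPAIRED: the binder «[SemiAnbd] Thm. 6.5 (iii)»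
# (`IsoPreservesCuspidalDecomp`, F-1674) is FALSE there as typed — and UNNECESSARY: the normaliser witness
# `inclX(ab)·ε_±` gives Cor. 2.9 GIVEN ONLY Prop. 2.6 (proof-only)

S. Mochizuki, *The étale theta function and its Frobenioid-theoretic manifestations*, Publ. RIMS **45** (2009) [EtTh], §2:
Def. 2.1 p. 36, Prop. 2.6 p. 40, Cor. 2.9 p. 43 [cite: MochizukiEtTh2009, Cor 2.9 p.43]; S. Mochizuki, *Semi-graphs of
anabelioids*, Publ. RIMS **42** (2006) [SemiAnbd], Thm. 6.5 (iii) p. 72 [cite: MochizukiSemiAnbd2006, Thm 6.5(iii) p.72].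
Cell abc-iut, layer L2, seat abc-iut-L2-t10 (gen 6), Krull row K10 = abc-iut-L2-lead R488 «Cor 2.9@κ′ (R-row of record) — GO».

FINDING (F-L2t10g6-2, vacuity class). This seat's K8 (`Sec2Cor29ModelKrull`, p447856 ✓) delivered Cor. 2.9 at
`inversionModelκ′` through abc-iut-L2-d3's cusp-law chain `exists_temperedCoverData_natCard_cuspOrbits_of_cuspLaws`, whose binder
`h65iii : IsoPreservesCuspidalDecomp (modelκ′) (modelκ′)` («EVERY topological automorphism of `Π^tp_X` preserves cuspidal
decomposition groups») is FALSE at `modelκ′` — abc-iut-w5-d165's `not_isoPreservesCuspidalDecomp_modelκ'` (the twist `θ_φ × id`,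
`φ = χ(σ₀) ∉ {±1}`, moves `c^Ẑ ⋊ G_{ℚ_p}` off the cusps). So K8's Cor. 2.9 clause was VACUOUS as typed. REPAIR (r1, no interface
touched): the chain uses `h65iii` ONLY to produce a normaliser witness `g ∈ Π^tp_C ∖ Π^tp_X` of `inclX(D_x)` (abc-iut-L2-d3's
`exists_not_mem_range_mem_normalizer_decomp` → `temperedCoverData_cor29_card (hfix)`); at `inversionModelκ′` that witness EXISTS
outright: `g₁ := inclX(inl(ab))·ε_±` CENTRALISES `inclX(D_x)` (abc-iut-L2-t5 g7's `sqrt_conj_inclX_eq` /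
`epsPM_conj_inclX_of_mem_cuspDecompκ`, the «orbifold cusp of `Ċ`» element `Γ₀·ε_±`, `g₁² = inclX(c)`).

* §1 (any `MuTwoSetting`): `MuTwoSetting.exists_not_mem_range_mem_normalizer_of_sqrt` — from abc-iut-L2-t5's conjugation
  hypothesis `hΓ₀` on `H`, the witness `inclX(Γ₀)·ε_± ∉ inclX(Π^tp_X)` normalising `inclX(H)`;
  `CLevelData.exists_temperedCoverData_cor29_card_of_cuspLaws_of_normalizer` — abc-iut-L2-d3's
  `exists_temperedCoverData_cor29_card_of_cuspLaws` with `h65iii` REPLACED by the normaliser witness `hfix` (strictly weaker: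
  `h65iii ⇒ hfix` is abc-iut-L2-d3's `exists_not_mem_range_mem_normalizer_decomp`).
* §2 (at `κ′`): `hfix_inversionModelκ'` (the witness for `D_x = c^Ẑ ⋊ G_{ℚ_p}`); **`exists_temperedCoverData_cor29_of_prop26_inversionModelκ'_repaired`**
  — for odd `l`, a `TemperedCoverData l` on THE `Π^tp_C` of `inversionModelκ′` realising the model's cover-data axioms with
  **`T.Prop26 → T.Cor29_card`**, NO `h65iii`; census pair `not_h65iii_and_cor29_repaired_inversionModelκ'` (the binder is false AND the
  conclusion is reachable without it). Residual of the R-row at `κ′` = {Prop. 2.6 (F-0610)} — `μ_l ⊆ K` sits INSIDE the typed `Cor29_card`.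

HONEST LIMITS: semi-synthetic model (untwisted Galois action; no `EtaleThetaData` exists at `κ′`, this seat's K7) = consistency evidence for
the typed §2 interface only; `T.Prop26` stays a binder; nothing of [EtTh]/[SemiAnbd] asserted or denied for genuine tempered fundamental
groups (there Thm. 6.5 (iii) concerns isomorphisms arising from curves); no side taken on [IUTchIII] Cor. 3.12; typed ≠ proved.
-/

noncomputable section

namespace Literature.AnabelianGeometry.EtaleTheta

open Literature.AnabelianGeometry.SemiGraphs ThetaCovers
open Literature.AlgebraicGeometry.Frobenioids (IsSlimGroup)
open scoped Pointwise

/-! ## §1. Generic: the normaliser witness replaces [SemiAnbd] Thm. 6.5 (iii) in the Cor. 2.9 chain -/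

namespace MuTwoSetting

variable {p : ℕ} [Fact p.Prime] {M : MuTwoSetting p}

/-- **The normaliser witness from abc-iut-L2-t5's centralising element**: if `ε_±` conjugates `inclX(d)` to `inclX(Γ₀⁻¹ d Γ₀)` on
`H`, then `g₁ := inclX(Γ₀)·ε_±` lies outside `inclX(Π^tp_X)` and normalises (indeed centralises) `inclX(H)`.
[cite: MochizukiEtTh2009, Def 2.1 p.36] -/
theorem exists_not_mem_range_mem_normalizer_of_sqrt {H : Subgroup M.PiTemp} {Γ₀ : M.PiTemp}
    (hΓ₀ : ∀ d ∈ H, M.epsPM * M.inclX d * M.epsPM⁻¹ = M.inclX (Γ₀⁻¹ * d * Γ₀)) :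
    ∃ g : M.GtpC, g ∉ M.inclX.range ∧
      g ∈ Subgroup.normalizer ((H.map M.inclX : Subgroup M.GtpC) : Set M.GtpC) := by
  refine ⟨M.inclX Γ₀ * M.epsPM, ?_, ?_⟩
  · rw [MonoidHom.range_eq_map]
    exact sqrt_not_mem_map_inclX ⊤ Γ₀
  · rw [Subgroup.mem_normalizer_iff]
    intro h
    constructor
    · rintro ⟨d, hd, rfl⟩
      rw [sqrt_conj_inclX_eq hΓ₀ hd]
      exact ⟨d, hd, rfl⟩
    · rintro ⟨d, hd, hEq⟩
      have h1 := sqrt_conj_inclX_eq hΓ₀ hd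
      have h2 : h = M.inclX d := by
        calc h = (M.inclX Γ₀ * M.epsPM)⁻¹ * ((M.inclX Γ₀ * M.epsPM) * h * (M.inclX Γ₀ * M.epsPM)⁻¹) *
              (M.inclX Γ₀ * M.epsPM) := by group
          _ = (M.inclX Γ₀ * M.epsPM)⁻¹ * M.inclX d * (M.inclX Γ₀ * M.epsPM) := by rw [← hEq]
          _ = (M.inclX Γ₀ * M.epsPM)⁻¹ * ((M.inclX Γ₀ * M.epsPM) * M.inclX d * (M.inclX Γ₀ * M.epsPM)⁻¹) *
              (M.inclX Γ₀ * M.epsPM) := by rw [h1]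
          _ = M.inclX d := by group
      rw [h2]
      exact ⟨d, hd, rfl⟩

end MuTwoSetting

namespace MuTwoSetting.CLevelData

variable {p : ℕ} [Fact p.Prime] {M : MuTwoSetting p}
variable {PC : Type} [Group PC] [TopologicalSpace PC] [IsTopologicalGroup PC] [T2Space PC]

/-- **Cor. 2.9 for SOME assembled cover from the cusp laws, [SemiAnbd] Thm. 6.5 (iii) REPLACED by a normaliser witness**
(`hfix : ∃ g ∈ Π^tp_C ∖ Π^tp_X` normalising `inclX(D_x)`) — abc-iut-L2-d3's `exists_temperedCoverData_cor29_card_of_cuspLaws` with the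
strictly weaker input (their `exists_not_mem_range_mem_normalizer_decomp` derives `hfix` from `h65iii` + «unique cusp»); residual =
{slimness of `Π^tp_C`, `T.Prop26`, [SemiAnbd] Thm. 6.5 (ii) (`DecompCommensurablyTerminal`), `hfix`}. [cite: MochizukiEtTh2009, Cor 2.9 p.43] -/
theorem exists_temperedCoverData_cor29_card_of_cuspLaws_of_normalizer (e : M.CLevelData) (ιC : M.GtpC →ₜ* PC)
    (hιC : IsProfiniteCompletion ιC) (hinj : Function.Injective ιC)
    (op : M.toThetaSetting.OncePuncturedData) (hL : M.toThetaSetting.CuspLaws) {l : ℕ} (hodd : Odd l)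
    {x : M.Pt} (hx : M.IsCusp x)
    (hιell : ∀ c ∈ (e.piCDataOf ιC hιC).augGK.ker, c ∉ (e.piCDataOf ιC hιC).PiX →
      ∀ d ∈ (e.piCDataOf ιC hιC).PiX ⊓ (e.piCDataOf ιC hιC).augGK.ker,
        c * d * c⁻¹ * d ∈ (e.piCDataOf ιC hιC).barTheta l)
    (h02 : Thm16Sub.KerToZIsCompactlyGenerated M.toThetaSetting) (hslim : IsSlimGroup M.GtpC)
    (h65 : M.toTemperedCurve.DecompCommensurablyTerminal)
    (hfix : ∃ g : M.GtpC, g ∉ M.inclX.range ∧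
      g ∈ Subgroup.normalizer (((M.decomp x).map M.inclX : Subgroup M.GtpC) : Set M.GtpC)) :
    ∃ T : TemperedCoverData.{0} l,
      T.toCoverDataAx = (e.piCDataOf ιC hιC).coverDataAx l op hx hodd
        (e.piCDataOf_hIx_of_cuspLaws ιC hιC op hL hodd hx) hιell
        ((e.piCDataOf ιC hιC).inv_theta_of_inv_ell l op hιell) ∧ (T.Prop26 → T.Cor29_card) := by
  obtain ⟨s, hs, hsa, hsc⟩ := hL.exists_section hx
  refine ⟨e.temperedCoverData ιC hιC hinj op hodd hx (e.piCDataOf_hIx_of_cuspLaws ιC hιC op hL hodd hx) hιell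
      (e.map_inclX_GtpXu_normal l h02) (e.map_inclX_GtpY_normal h02)
      ((e.piCDataOf ιC hιC).isSplitting_of_section l op hx hodd _ hιell _ s hs hsa)
      ((e.piCDataOf ιC hιC).isClosed_splittingOfSection l op s hsc),
    e.temperedCoverData_toCoverDataAx ιC hιC hinj op hodd hx _ hιell _ _ _ _, fun h26 => ?_⟩
  exact temperedCoverData_cor29_card e ιC hιC hinj op hodd hx _ hιell _ _ _ _ hslim h26 (op.isCompact_decomp x)
    h65 hfix

end MuTwoSetting.CLevelData

/-! ## §2. At the cusped untwisted Krull model `κ′` -/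

namespace SettingModel

variable (p : ℕ) [Fact p.Prime]

/-- **The normaliser witness at `inversionModelκ′`**: `g₁ := inclX(inl(ab))·ε_± ∈ Π^tp_C ∖ Π^tp_X` normalises `inclX(D_x)` for the
cusp decomposition group `D_x = c^Ẑ ⋊ G_{ℚ_p}` of the model's cusp (abc-iut-L2-t5 g7's `epsPM_conj_inclX_of_mem_cuspDecompκ`).
[cite: MochizukiEtTh2009, Def 2.1 p.36] -/
theorem hfix_inversionModelκ' :
    ∃ g : (MuTwoSetting.inversionModelκ' p).GtpC, g ∉ (MuTwoSetting.inversionModelκ' p).inclX.range ∧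
      g ∈ Subgroup.normalizer
        ((((ThetaSetting.modelκ' p).decomp ()).map (MuTwoSetting.inversionModelκ' p).inclX :
            Subgroup (MuTwoSetting.inversionModelκ' p).GtpC) : Set (MuTwoSetting.inversionModelκ' p).GtpC) :=
  MuTwoSetting.exists_not_mem_range_mem_normalizer_of_sqrt (epsPM_conj_inclX_of_mem_cuspDecompκ p)

/-- **R-row of record at `κ′`, REPAIRED — [EtTh] Cor. 2.9 at `inversionModelκ′` GIVEN ONLY Prop. 2.6**: for odd `l` and the
once-punctured bundle `eX`, a `TemperedCoverData l` on THE `Π^tp_C` realising the model's cover-data axioms (geometric cusp datum,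
hIx TRUE at `κ′`) with `T.Prop26 → T.Cor29_card`; NO [SemiAnbd] Thm. 6.5 (iii) binder (false at `κ′`), slimness / Thm. 6.5 (ii) /
L02 / P-C4 / the normaliser witness all THEOREMS here. [cite: MochizukiEtTh2009, Cor 2.9 p.43] -/
theorem exists_temperedCoverData_cor29_of_prop26_inversionModelκ'_repaired {l : ℕ} (hodd : Odd l)
    (eX : (ThetaSetting.modelκ' p).OncePuncturedData) :
    ∃ T : TemperedCoverData.{0} l,
      T.toCoverDataAx = ((cLevelDataInvκ' p).piCDataOf (toHatCκ p) (isProfiniteCompletion_toHatCκ p)).coverDataAx l eX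
        (x := ()) trivial hodd (hIx_piCDataOf_toHatCκ p l hodd.pos eX ())
        (inv_ell_piCDataOf_toHatCκ p l eX) (inv_theta_piCDataOf_toHatCκ p l eX) ∧
      (T.Prop26 → T.Cor29_card) :=
  (cLevelDataInvκ' p).exists_temperedCoverData_cor29_card_of_cuspLaws_of_normalizer (toHatCκ p)
    (isProfiniteCompletion_toHatCκ p) (toHatCκ_injective p) eX (cuspLaws_modelκ' p) hodd (x := ()) trivial
    (inv_ell_piCDataOf_toHatCκ p l eX) (kerToZIsCompactlyGenerated_modelκ' p) (isSlimGroup_GtpC_inversionModelκ' p)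
    (decompCommensurablyTerminal_curveκ' p) (hfix_inversionModelκ' p)

/-- **CENSUS PAIR (FINDING F-L2t10g6-2 and its repair, in the kernel)**: at `κ′` the K8 chain's binder «[SemiAnbd] Thm. 6.5 (iii)
for all topological automorphisms» is FALSE (abc-iut-w5-d165's `not_isoPreservesCuspidalDecomp_modelκ'`, BY NAME) — so K8's Cor. 2.9
clause was vacuous as typed — AND Cor. 2.9 given only Prop. 2.6 is nevertheless REACHED there without it.
[cite: MochizukiEtTh2009, Cor 2.9 p.43] -/
theorem not_h65iii_and_cor29_repaired_inversionModelκ' {l : ℕ} (hodd : Odd l) :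
    ¬ (ThetaSetting.modelκ' p).IsoPreservesCuspidalDecomp (ThetaSetting.modelκ' p).toTemperedCurve ∧
      ∀ eX : (ThetaSetting.modelκ' p).OncePuncturedData, ∃ T : TemperedCoverData.{0} l,
        T.toCoverDataAx = ((cLevelDataInvκ' p).piCDataOf (toHatCκ p) (isProfiniteCompletion_toHatCκ p)).coverDataAx l eX
          (x := ()) trivial hodd (hIx_piCDataOf_toHatCκ p l hodd.pos eX ())
          (inv_ell_piCDataOf_toHatCκ p l eX) (inv_theta_piCDataOf_toHatCκ p l eX) ∧
        (T.Prop26 → T.Cor29_card) :=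
  ⟨not_isoPreservesCuspidalDecomp_modelκ' p, exists_temperedCoverData_cor29_of_prop26_inversionModelκ'_repaired p hodd⟩

end SettingModel


/-! ## v2 (append-only). The typed antecedent `HasMuL` («`Π_C` acts trivially on `Δ̄_Θ`», print's «`μ_l ⊆ K`») DISCHARGED too -/

namespace MuTwoSetting.CLevelData

variable {p : ℕ} [Fact p.Prime] {M : MuTwoSetting p}
variable {PC : Type} [Group PC] [TopologicalSpace PC] [IsTopologicalGroup PC] [T2Space PC]

/-- **Cor. 2.9 for SOME assembled cover from the cusp laws WITH `T.HasMuL`**, Thm. 6.5 (iii) replaced by the normaliser witness: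
if moreover `Π^tp_X` acts trivially on `Δ_Θ / l·Δ_Θ` (`hμ`, the shape abc-iut-L2-d3's `temperedCoverData_hasMuL` consumes), the cover
ALSO satisfies the typed antecedent `HasMuL` of Rmk. 2.6.1 / Cor. 2.9 — so `T.Cor29_card` (`HasMuL → counts`) fires given Prop. 2.6.
[cite: MochizukiEtTh2009, Cor 2.9 p.43] -/
theorem exists_temperedCoverData_hasMuL_cor29_card_of_cuspLaws_of_normalizer (e : M.CLevelData) (ιC : M.GtpC →ₜ* PC)
    (hιC : IsProfiniteCompletion ιC) (hinj : Function.Injective ιC)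
    (op : M.toThetaSetting.OncePuncturedData) (hL : M.toThetaSetting.CuspLaws) {l : ℕ} (hodd : Odd l)
    {x : M.Pt} (hx : M.IsCusp x)
    (hιell : ∀ c ∈ (e.piCDataOf ιC hιC).augGK.ker, c ∉ (e.piCDataOf ιC hιC).PiX →
      ∀ d ∈ (e.piCDataOf ιC hιC).PiX ⊓ (e.piCDataOf ιC hιC).augGK.ker,
        c * d * c⁻¹ * d ∈ (e.piCDataOf ιC hιC).barTheta l)
    (h02 : Thm16Sub.KerToZIsCompactlyGenerated M.toThetaSetting) (hslim : IsSlimGroup M.GtpC)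
    (h65 : M.toTemperedCurve.DecompCommensurablyTerminal)
    (hfix : ∃ g : M.GtpC, g ∉ M.inclX.range ∧
      g ∈ Subgroup.normalizer (((M.decomp x).map M.inclX : Subgroup M.GtpC) : Set M.GtpC))
    (hμ : ∀ (σ : M.PiTemp) (a : M.GtpTheta), a ∈ M.DeltaTheta →
      M.toTheta σ * a * (M.toTheta σ)⁻¹ * a⁻¹ ∈ M.lDeltaTheta l) :
    ∃ T : TemperedCoverData.{0} l,
      T.toCoverDataAx = (e.piCDataOf ιC hιC).coverDataAx l op hx hodd
        (e.piCDataOf_hIx_of_cuspLaws ιC hιC op hL hodd hx) hιell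
        ((e.piCDataOf ιC hιC).inv_theta_of_inv_ell l op hιell) ∧ T.HasMuL ∧ (T.Prop26 → T.Cor29_card) := by
  obtain ⟨s, hs, hsa, hsc⟩ := hL.exists_section hx
  refine ⟨e.temperedCoverData ιC hιC hinj op hodd hx (e.piCDataOf_hIx_of_cuspLaws ιC hιC op hL hodd hx) hιell
      (e.map_inclX_GtpXu_normal l h02) (e.map_inclX_GtpY_normal h02)
      ((e.piCDataOf ιC hιC).isSplitting_of_section l op hx hodd _ hιell _ s hs hsa)
      ((e.piCDataOf ιC hιC).isClosed_splittingOfSection l op s hsc),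
    e.temperedCoverData_toCoverDataAx ιC hιC hinj op hodd hx _ hιell _ _ _ _,
    e.temperedCoverData_hasMuL ιC hιC hinj op hodd hx _ hιell _ _ _ _ hμ, fun h26 => ?_⟩
  exact temperedCoverData_cor29_card e ιC hιC hinj op hodd hx _ hιell _ _ _ _ hslim h26 (op.isCompact_decomp x)
    h65 hfix

end MuTwoSetting.CLevelData

namespace SettingModel

variable (p : ℕ) [Fact p.Prime]

/-- **At `κ′` the typed antecedent «`Π^tp_X` acts trivially on `Δ_Θ / l·Δ_Θ`» holds for EVERY `l`** — indeed `(Π^tp_X)^Θ`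
CENTRALISES `Δ_Θ` at the untwisted Krull record (this seat's K7 `toTheta_conj_eq_of_mem_deltaTheta_modelκ'`), so every commutator is
`1`. HONEST CENSUS: the typed `HasMuL` is thereby WEAKER than print's «`μ_l ⊆ K`» at this carrier — for odd `l ∤ p − 1` one has
`μ_l ⊄ ℚ_p = K` and NO cyclotome datum `CyclotomeMod 1 l` (K11 `isEmpty_cyclotomeMod_one_modelκ'_of_odd_not_dvd`), yet `HasMuL` holds.
[cite: MochizukiEtTh2009, Rmk 2.6.1 p.40] -/
theorem conj_commutator_mem_lDeltaTheta_inversionModelκ' (l : ℕ) (σ : (MuTwoSetting.inversionModelκ' p).PiTemp)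
    (a : (MuTwoSetting.inversionModelκ' p).GtpTheta) (ha : a ∈ (MuTwoSetting.inversionModelκ' p).DeltaTheta) :
    (MuTwoSetting.inversionModelκ' p).toTheta σ * a * ((MuTwoSetting.inversionModelκ' p).toTheta σ)⁻¹ * a⁻¹ ∈
      (MuTwoSetting.inversionModelκ' p).lDeltaTheta l := by
  rw [toTheta_conj_eq_of_mem_deltaTheta_modelκ' p _ a ha, mul_inv_cancel]
  exact one_mem _

/-- **R-row of record at `κ′`, v2 — [EtTh] Cor. 2.9 at `inversionModelκ′` GIVEN ONLY Prop. 2.6, with the typed antecedent `HasMuL`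
DISCHARGED**: for odd `l` and the bundle `eX`, a `TemperedCoverData l` on THE `Π^tp_C` realising the model's cover-data axioms with
`T.HasMuL` (a theorem at `κ′`, for every `l`) and `T.Prop26 → T.Cor29_card`; residual = {Prop. 2.6 (F-0610), UNDECIDED at `κ′` — NV question
Q-L2t10g6-P26κ′, abc-iut-L2-lead R540}. [cite: MochizukiEtTh2009, Cor 2.9 p.43] -/
theorem exists_temperedCoverData_hasMuL_cor29_inversionModelκ' {l : ℕ} (hodd : Odd l)
    (eX : (ThetaSetting.modelκ' p).OncePuncturedData) :
    ∃ T : TemperedCoverData.{0} l,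
      T.toCoverDataAx = ((cLevelDataInvκ' p).piCDataOf (toHatCκ p) (isProfiniteCompletion_toHatCκ p)).coverDataAx l eX
        (x := ()) trivial hodd (hIx_piCDataOf_toHatCκ p l hodd.pos eX ())
        (inv_ell_piCDataOf_toHatCκ p l eX) (inv_theta_piCDataOf_toHatCκ p l eX) ∧
      T.HasMuL ∧ (T.Prop26 → T.Cor29_card) :=
  (cLevelDataInvκ' p).exists_temperedCoverData_hasMuL_cor29_card_of_cuspLaws_of_normalizer (toHatCκ p)
    (isProfiniteCompletion_toHatCκ p) (toHatCκ_injective p) eX (cuspLaws_modelκ' p) hodd (x := ()) trivial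
    (inv_ell_piCDataOf_toHatCκ p l eX) (kerToZIsCompactlyGenerated_modelκ' p) (isSlimGroup_GtpC_inversionModelκ' p)
    (decompCommensurablyTerminal_curveκ' p) (hfix_inversionModelκ' p) (conj_commutator_mem_lDeltaTheta_inversionModelκ' p l)

end SettingModel


/-! ## v3 (append-only). CENSUS OF RECORD at `κ′`, UNPACKED: Rmk. 2.6.1 UNCONDITIONAL, the six-member Cor. 2.9 count GIVEN ONLY Prop. 2.6 -/

namespace SettingModel

variable (p : ℕ) [Fact p.Prime]

/-- **[EtTh] Rmk. 2.6.1 and Cor. 2.9 at `inversionModelκ′` — THE CENSUS OF RECORD, unpacked.** For odd `l ≠ 1` and the bundle `eX`, THE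
cusp-law cover `T` of K8 (abc-iut-L2-d3's `temperedCoverData` over `toHatCκ` with the section splitting) satisfies: (i) the κ′
cover-data axioms (geometric cusp datum); (ii) `HasMuL` (K10 v2, K7 centrality — for EVERY `l`, no `μ_l ⊆ K`, no cyclotome datum);
(iii) **Rmk. 2.6.1 UNCONDITIONALLY**: `Aut_K(X̲̲) ≅ ℤ/l × ℤ/2`, `Aut_K(X̲) ≅ D_l`, `Aut_K(C̲̲) ≅ ℤ/l`, `Aut_K(C̲) = 1` (abc-iut-f-144's
`rmk261_ofSetting` fed with (ii)); (iv) the dotted Rmk. 2.6.1 GIVEN ONLY Prop. 2.6 (`rmk261_dotted_ofSetting_of_slimX`, slim `Π^tp_X`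
= `isSlimGroup_PiTpκ`); (v) **the six-member count «each of `Ẋ̲̲, Ċ̲, Ċ̲̲, X̲̲, C̲, C̲̲` has `(l+1)/2` `Aut_K`-orbits of cusps» GIVEN ONLY
Prop. 2.6** (`temperedCoverData_cor29_card` with the normaliser witness `hfix_inversionModelκ'`, fed with (ii)). So the binders
{`IsoPreservesCuspidalDecomp` (false at κ′), `μ : CyclotomeMod 1 l` (∅ off `l ∣ p − 1`, K11), `hμK` (⇔ `l ∣ p − 1`, K12)} of K8's
route are ALL IDLE for Rmk. 2.6.1 / Cor. 2.9 at `κ′`; residual = {Prop. 2.6 (F-0610), for (iv)/(v) only; UNDECIDED at κ′, Q-L2t10g6-P26κ′}.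
[cite: MochizukiEtTh2009, Cor 2.9 p.43] -/
theorem exists_temperedCoverData_rmk261_cor29_census_inversionModelκ' {l : ℕ} [NeZero l] (hodd : Odd l) (hl : l ≠ 1)
    (eX : (ThetaSetting.modelκ' p).OncePuncturedData) :
    ∃ T : TemperedCoverData.{0} l,
      T.toCoverDataAx = ((cLevelDataInvκ' p).piCDataOf (toHatCκ p) (isProfiniteCompletion_toHatCκ p)).coverDataAx l eX
        (x := ()) trivial hodd (hIx_piCDataOf_toHatCκ p l hodd.pos eX ())
        (inv_ell_piCDataOf_toHatCκ p l eX) (inv_theta_piCDataOf_toHatCκ p l eX) ∧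
      T.HasMuL ∧
      (Nonempty (T.autK (T.tp T.PiXuu) ≃* Multiplicative (ZMod l) × Multiplicative (ZMod 2)) ∧
        Nonempty (T.autK (T.tp T.PiXu) ≃* DihedralGroup l) ∧
        Nonempty (T.autK (T.tp T.PiCuu) ≃* Multiplicative (ZMod l)) ∧
        Subsingleton (T.autK (T.tp T.PiCu))) ∧
      (T.Prop26 → T.Rmk261_dotted) ∧
      (T.Prop26 → ∀ S' ∈ [T.tp T.PiXuu ⊓ T.PiCdot, T.tp T.PiCu ⊓ T.PiCdot, T.tp T.PiCuu ⊓ T.PiCdot,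
          T.tp T.PiXuu, T.tp T.PiCu, T.tp T.PiCuu], Nat.card (T.cuspOrbits S') = (l + 1) / 2) := by
  obtain ⟨s, hs, hsa, hsc⟩ := (cuspLaws_modelκ' p).exists_section (x := ()) trivial
  have hMuL := (cLevelDataInvκ' p).temperedCoverData_hasMuL (toHatCκ p) (isProfiniteCompletion_toHatCκ p)
      (toHatCκ_injective p) eX hodd (x := ()) trivial (hIx_piCDataOf_toHatCκ p l hodd.pos eX ())
      (inv_ell_piCDataOf_toHatCκ p l eX)
      ((cLevelDataInvκ' p).map_inclX_GtpXu_normal l (kerToZIsCompactlyGenerated_modelκ' p))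
      ((cLevelDataInvκ' p).map_inclX_GtpY_normal (kerToZIsCompactlyGenerated_modelκ' p))
      (((cLevelDataInvκ' p).piCDataOf (toHatCκ p) (isProfiniteCompletion_toHatCκ p)).isSplitting_of_section l eX
        (x := ()) trivial hodd _ (inv_ell_piCDataOf_toHatCκ p l eX) _ s hs hsa)
      (((cLevelDataInvκ' p).piCDataOf (toHatCκ p) (isProfiniteCompletion_toHatCκ p)).isClosed_splittingOfSection l eX s hsc)
      (conj_commutator_mem_lDeltaTheta_inversionModelκ' p l)
  refine ⟨_, (cLevelDataInvκ' p).temperedCoverData_toCoverDataAx (toHatCκ p) (isProfiniteCompletion_toHatCκ p)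
      (toHatCκ_injective p) eX hodd trivial _ (inv_ell_piCDataOf_toHatCκ p l eX) _ _ _ _, hMuL, ?_, fun h26 => ?_,
    fun h26 => ?_⟩
  · exact (cLevelDataInvκ' p).rmk261_ofSetting (toHatCκ p) (isProfiniteCompletion_toHatCκ p) (toHatCκ_injective p) eX
      hodd trivial _ (inv_ell_piCDataOf_toHatCκ p l eX) _ _ _ _ hMuL
  · exact (cLevelDataInvκ' p).rmk261_dotted_ofSetting_of_slimX (toHatCκ p) (isProfiniteCompletion_toHatCκ p)
      (toHatCκ_injective p) eX hodd hl trivial _ (inv_ell_piCDataOf_toHatCκ p l eX) _ _ _ _ (isSlimGroup_PiTpκ p) h26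
  · exact (cLevelDataInvκ' p).temperedCoverData_cor29_card (toHatCκ p) (isProfiniteCompletion_toHatCκ p)
      (toHatCκ_injective p) eX hodd trivial _ (inv_ell_piCDataOf_toHatCκ p l eX) _ _ _ _
      (isSlimGroup_GtpC_inversionModelκ' p) h26 (eX.isCompact_decomp ()) (decompCommensurablyTerminal_curveκ' p)
      (hfix_inversionModelκ' p) hMuL

end SettingModel

end Literature.AnabelianGeometry.EtaleTheta

end
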